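import Summits.AnomalousDissipation.AnomalousDissipation.Theorems.SawtoothPulseCascadeK1LocalisedCascadeKHSheetSigmaTable

/-!
# K2 lane (route-2 `SawtoothPulseCascade`, crux dir `K1LocalisedCascade`): S2 on STABLE lines from the oscillatory bound (recipe R4)

Helper file of the K2 lane (S2 `KHSheetAbsolute`; ACL item stmt-AnomalousDissipation-19491). On a stable line (`c²(k,β) > 0`, e.g. every
`k ≥ 0.7638`) the propagator pair is `(cos ωθ, sin ωθ/ω)`, `ω² = k²c²`, so `2τ(θ) = 2cos² + 2 sin²·(k²W/ω²) ≤ max(2, 2W/c²)` uniformly in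
`θ` — no growth with the slot length. `sheet_energy_le_of_stable_bound`: if `2 ≤ B²` and `2W ≤ B²·c²(k,β)` (`W = ½(F₋²ρ + F₊²/ρ)` in product
form) then every S2-stub solution on `[0,γ]` obeys `khForm(q θ) ≤ B² khForm(q 0)`; this is the large-`k` end of the S2 table
(`2W/c² = F₋ρ/F₊ + F₊/(F₋ρ) → 2` as `k → ∞`; memo `Cruxes/K1LocalisedCascade/K2SheetBlockPropagator.md` §7 R4). No definitions; no
statement about the crux. [cite: Drazin2002, §8.3 (8.36)–(8.38) (Rayleigh jump conditions at the kinks of a broken-line profile)] [problem: turb]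
-/

-- `Summit.<Summit>.<Problem>`: single-conjunct summit, the duplicate namespace segment is deliberate.
set_option linter.dupNamespace false

noncomputable section

namespace Summit.AnomalousDissipation.AnomalousDissipation.Theorems.SawtoothPulseCascade.K2PhaseBudget

open Set Real Complex Literature.Analysis.FluidPDE.SawtoothCascade

/-- **S2 on a stable line.** See the module docstring. [cite: Drazin2002, §8.3 (8.36)–(8.38)] -/
theorem sheet_energy_le_of_stable_bound {k β γ B : ℝ} (hk : 0 < k) (hc : 0 < sawC2 k β) (hB2 : 2 ≤ B ^ 2)
    {p S : ℂ} {m : ℝ} {F : (Fin 2 → ℂ) → (Fin 2 → ℂ)}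
    (hp : p = ((π / 2 + 2 * sawSigma0 k β : ℝ) : ℂ)) (hS : S = sawS k β) (hm : m = -sawSigma0 k β)
    (hF : F = fun v => ![I * k * (-p * v 0 - 2 * S * v 1), I * k * (2 * (starRingEnd ℂ) S * v 0 + p * v 1)])
    (hW : 2 * (((π / 2 - Real.sinh (π * k) / (k * (Real.cosh (π * k) - |Real.cos (π * β)|))) ^ 2 *
              ((Real.cosh (π * k) - |Real.cos (π * β)|) / (Real.cosh (π * k) + |Real.cos (π * β)|)) +
            (π / 2 - Real.sinh (π * k) / (k * (Real.cosh (π * k) + |Real.cos (π * β)|))) ^ 2 *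
              ((Real.cosh (π * k) + |Real.cos (π * β)|) / (Real.cosh (π * k) - |Real.cos (π * β)|))) / 2) ≤
          B ^ 2 * sawC2 k β)
    {q : ℝ → (Fin 2 → ℂ)} (hq : ∀ θ ∈ Icc (0 : ℝ) γ, HasDerivWithinAt q (F (q θ)) (Icc (0 : ℝ) γ) θ) :
    ∀ θ ∈ Icc (0 : ℝ) γ,
      m * (Complex.normSq (q θ 0) + Complex.normSq (q θ 1)) - 2 * ((starRingEnd ℂ) (q θ 0) * S * q θ 1).re ≤
        B ^ 2 * (m * (Complex.normSq (q 0 0) + Complex.normSq (q 0 1)) - 2 * ((starRingEnd ℂ) (q 0 0) * S * q 0 1).re) := by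
  subst hS
  have hWeq := sheetW_eq_productForm hk β hm
  set Wp := ((π / 2 - Real.sinh (π * k) / (k * (Real.cosh (π * k) - |Real.cos (π * β)|))) ^ 2 *
        ((Real.cosh (π * k) - |Real.cos (π * β)|) / (Real.cosh (π * k) + |Real.cos (π * β)|)) +
      (π / 2 - Real.sinh (π * k) / (k * (Real.cosh (π * k) + |Real.cos (π * β)|))) ^ 2 *
        ((Real.cosh (π * k) + |Real.cos (π * β)|) / (Real.cosh (π * k) - |Real.cos (π * β)|))) / 2 with hWp
  have hx : 0 < π * k := by positivity
  have hC1 : 1 < Real.cosh (π * k) := Real.one_lt_cosh.2 hx.ne'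
  have hγ1 : |Real.cos (π * β)| ≤ 1 := Real.abs_cos_le_one _
  have hWp0 : 0 ≤ Wp := by
    rw [hWp]
    have h1 : 0 < Real.cosh (π * k) - |Real.cos (π * β)| := by linarith
    have h2 : 0 < Real.cosh (π * k) + |Real.cos (π * β)| := by linarith [abs_nonneg (Real.cos (π * β))]
    positivity
  apply sheet_energy_le_of_trace_table hk hp rfl hm hF _ hq
  intro θ hθ C Sn hpair
  rw [hWeq]
  rcases hpair with ⟨hneg, -, -⟩ | ⟨-, hC, hSn⟩ | ⟨hzero, -, -⟩
  · exact absurd hneg (not_lt.2 hc.le)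
  · -- stable pair
    set ω := k * Real.sqrt (sawC2 k β) with hω
    have hω2 : ω ^ 2 = k ^ 2 * sawC2 k β := by rw [hω, mul_pow, Real.sq_sqrt hc.le]
    have hω0 : 0 < ω := mul_pos hk (Real.sqrt_pos.2 hc)
    have hcs : Real.cos (ω * θ) ^ 2 + Real.sin (ω * θ) ^ 2 = 1 := by rw [add_comm]; exact Real.sin_sq_add_cos_sq _
    rw [hC, hSn, div_pow]
    -- `2cos² + 2 (sin²/ω²) k² W ≤ B² cos² + B² sin²`
    have h1 : 2 * Real.cos (ω * θ) ^ 2 ≤ B ^ 2 * Real.cos (ω * θ) ^ 2 :=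
      mul_le_mul_of_nonneg_right hB2 (sq_nonneg _)
    have h2 : 2 * (Real.sin (ω * θ) ^ 2 / ω ^ 2 * k ^ 2 * Wp) ≤ B ^ 2 * Real.sin (ω * θ) ^ 2 := by
      rw [hω2]
      have hkc : 0 < k ^ 2 * sawC2 k β := by positivity
      rw [show 2 * (Real.sin (ω * θ) ^ 2 / (k ^ 2 * sawC2 k β) * k ^ 2 * Wp) =
          Real.sin (ω * θ) ^ 2 * (2 * Wp) / sawC2 k β by field_simp]
      rw [div_le_iff₀ hc]
      have := mul_le_mul_of_nonneg_left hW (sq_nonneg (Real.sin (ω * θ)))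
      linarith
    nlinarith
  · exact absurd hzero hc.ne'

end Summit.AnomalousDissipation.AnomalousDissipation.Theorems.SawtoothPulseCascade.K2PhaseBudget

end
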